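import Literature.AlgebraicGeometry.Frobenioids.DivisorMonoidBirationalStandardProofs
import Literature.AlgebraicGeometry.Frobenioids.BirationalizationIstrComparison
import Literature.AlgebraicGeometry.Frobenioids.BirationalizationBiratData
import HarnessLib

/-!
# Frobenioids I, Proposition 4.8 (iii) at THE birationalization, in the typed hypothesis vocabulary —
# modulo the single residual condition (b) of Def. 3.1 (i)

Mochizuki, *The geometry of Frobenioids I: the general theory*, Kyushu J. Math. **62** (2008)
293–400, §4, Proposition 4.8 (iii), kurims text p. 88 [cite: MochizukiFrdI2008, Prop. 4.8 (iii) p.88]: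
"(iii) If `C` is of rationally standard type, then `(C^istr)^birat` is of standard type."

PROOF-ONLY assembly (theorems only) over: seat abc-iut-L1-t3's typed hypothesis
`PreFrobenioidData.IsOfRationallyStandardType S R` (Def. 4.5 (iii); `DivisorMonoidCategoryTheoreticityDefs`)
taken at `S := ofFunctor Φ F` and at parameters `R` whose birationalization datum `R.B` is THE one,
abc-iut-L6-t6's `biratData hF hsq` (`BirationalizationBiratData.lean`); abc-iut-L1-d5's comparison functor
`(C^istr)^birat → C^birat` (`BirationalizationIstrComparison.lean`, PIECE P48iii-c:
`Birat.isOfFrobeniusNormalizedType_istr_of` — "`C` birationally Frobenius-normalized ⇒ `(C^istr)^birat` of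
Frobenius-normalized type"); and this seat's `DivisorMonoidBirationalStandardProofs.lean` (no anchors in the
birationalization of the isotropic-type Frobenioid `C^istr` ⇒ quasi-isotropic; standard type modulo (b),
(c)). RESULT: `prop48iii_of_frobeniusCompact` — Def. 3.1 (i) "standard type" of
`(C^istr)^birat → F_{0_D}` from "`C` of rationally standard type", conditions (a), (c), (d), (e) DISCHARGED,
with the ONE remaining hypothesis (b) "`(C^istr)^birat` admits a Frobenius-compact object" — which print
derives from Def. 4.5 (iii)(b) "`(C^un-tr)^birat` admits a Frobenius-compact object" (transfer along
`(C^istr)^birat → (C^un-tr)^birat`: the unit groups surject with kernel `O^×(A)`, and a rational action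
trivial on a nonzero perfection is the identity); that transfer needs the birationalization of the
unit-trivialization `C^un-tr`, not yet constructed in the tree — the recorded residual of node
`FrdI:Prop4.8(iii)` (abc-iut cell, seat abc-iut-L6-t20). The typed parameter `R.BU` ("`(C^un-tr)^birat`") is a
free datum, so `R`'s own clause (b) cannot be used (P48-N1). No statement of the paper is strengthened;
nothing here concerns the disputed parts of IUT.
-/

namespace Literature.AlgebraicGeometry.Frobenioids

open CategoryTheory Opposite

universe w v v' u u'

namespace PreFrobenioidData

variable {D : Type u} [Category.{v} D] {Φ : Dᵒᵖ ⥤ CommMonCat.{w}}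
  {C : Type u'} [Category.{v'} C] {F : C ⥤ ElemFrobenioid Φ}

/-- "Frobenius-normalized object" through the adapter `ofFunctor` is found's notion (in `End A`,
`α ^ n * φ = φ ≫ α ^ n`). [cite: MochizukiFrdI2008, Def. 1.2 (iv) p.23] -/
theorem ofFunctor_isFrobeniusNormalized {E : Type u'} [Category.{v'} E] {Ψ : Dᵒᵖ ⥤ CommMonCat.{w}}
    (G : E ⥤ ElemFrobenioid Ψ) (A : E) :
    (ofFunctor Ψ G).IsFrobeniusNormalized A ↔ PreFrobenioid.IsFrobeniusNormalized G A :=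
  Iff.rfl

/-- **[FrdI] Proposition 4.8 (iii)**, modulo condition (b) of Def. 3.1 (i): for a Frobenioid `C` (over a
base `D`, divisor monoid `Φ`) which is of rationally standard type in the typed sense — at parameters
whose birationalization datum is THE birationalization `biratData hF hsq` — the birationalization
`(C^istr)^birat → F_{0_D}` of `C^istr` is of standard type, PROVIDED it admits a Frobenius-compact object
(condition (b); print: from Def. 4.5 (iii)(b) via `(C^un-tr)^birat`, the recorded residual). Uses: (d) from
`R`'s standard-type clause; (c) from `R`'s birational Frobenius-normalization transported along
abc-iut-L1-d5's faithful comparison functor `(C^istr)^birat → C^birat`; (a), (e): no anchors / zero monoid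
(`DivisorMonoidBirationalStandardProofs`). [cite: MochizukiFrdI2008, Prop. 4.8 (iii) p.88] -/
theorem prop48iii_of_frobeniusCompact (hF : PreFrobenioid.IsFrobenioid F)
    (hsq : PreFrobenioid.HasBiratSquares F)
    (hsq' : PreFrobenioid.HasBiratSquares (PreFrobenioid.istrFunctor F))
    (Supp : ∀ {X : D}, (ofFunctor Φ F).Mon X → Primes ((ofFunctor Φ F).Mon X) → Prop)
    (SU : PreFrobenioidData.{w} (ofFunctor Φ F).Untr D)
    (BU : BiratData.{w, v', v, u', u, max u' v'} SU)
    (hR : (ofFunctor Φ F).IsOfRationallyStandardType ⟨PreFrobenioid.biratData hF hsq, Supp, SU, BU⟩)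
    (hb : ∃ A, (ofFunctor (zeroMonoid D)
      (PreFrobenioid.Birat.toElemZero (PreFrobenioid.isFrobenioid_istr hF) hsq')).IsFrobeniusCompact A) :
    (ofFunctor (zeroMonoid D)
      (PreFrobenioid.Birat.toElemZero (PreFrobenioid.isFrobenioid_istr hF) hsq')).IsOfStandardType := by
  refine isOfStandardType_ofFunctor_toElemZero_istr_of hF hsq' hR.standard.fsmff hb ⟨fun X => ?_⟩
  refine (ofFunctor_isFrobeniusNormalized _ X).mpr
    (PreFrobenioid.Birat.isOfFrobeniusNormalizedType_istr_of (hF := hF) (hsq := hsq) (hsq' := hsq')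
      (fun A => ?_) X)
  exact (ofFunctor_isFrobeniusNormalized _ _).mp (hR.biratFrobNormalized.obj A)

end PreFrobenioidData

end Literature.AlgebraicGeometry.Frobenioids
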